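import Summits.Ventures.CertifiedArithmetic.LowPrec.DoubleRounding
import Summits.Ventures.CertifiedArithmetic.LowPrec.FormatsP3109

/-!
# Double rounding slips land on midpoints — Property 2.1 of Martin-Dorel–Melquiond–Muller for
# format records (THEOREMS D-dr / D-dm, the structural half)

HONEST FRAMING: certified error envelopes and provably optimal rounding/accumulation schemes for
low-precision formats under stated cost models; every table by two implementations; no hardware
or vendor claims.

[MartinDorelMelquiondMuller2013, Property 2.1] (unbounded exponents): if rounding a real to
precision `p + p'` (`p' ≥ 1`) and then to precision `p` differs from rounding it to precision `p`
directly — a DOUBLE ROUNDING SLIP — then the intermediate result is a precision-`p` MIDPOINT.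
This file proves the statement for every pair of FORMAT RECORDS `φ`, `ψ` of the cell's model
(saturating round-to-nearest-even, subnormals, no infinities) under `P_φ + 1 ≤ P_ψ`,
`bias φ ≤ bias ψ`, `maxRat φ ≤ maxRat ψ` — the hypotheses under which every value of `φ`
and every midpoint of two consecutive values of `φ` is a value of `ψ` (`Successor.lean`):

* `slip_midpoint_of_pos` / `slip_midpoint` — a slip at `x` forces `|fl_ψ x| = (v + u)/2` for
  two CONSECUTIVE values `0 ≤ v < u` of `φ` (no value of `φ` strictly between) that enclose
  `|x|` strictly; in particular `x` is not a value of `ψ`, `|x| < maxRat φ`, and `x ≠ fl_ψ x`;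
* `roundNE_roundNE_of_not_midpoint` — the usable contrapositive: off the midpoints of `φ` the
  double rounding through `ψ` is innocuous, whatever the operation that produced `x`.

The argument is the one inside the Lean seat's `toRat_roundNE_roundNE_add_of_pos`
(`DoubleRounding.lean`, there specialised to sums and closed by a counting contradiction):
`v = RD_φ x`, `u = v + ulp v`, `M = (v+u)/2 ∈ F_ψ`; `fl_ψ x` lies in `[v, M]` or `[M, u]` on
the side of `x` (monotonicity, `v, M, u ∈ F_ψ`), and `fl_φ` is constant on `[v, M)` and on
`(M, u]`.  Every failing cell of the decision matrices D-dr (sums) and D-dm (products,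
`DoubleRoundingProductCells.lean`) with `P_φ < P_ψ` is an instance: e2m3 products in binary8p5
slip at `5/8 · 15/8 = 75/64 ↦ 19/16 = (9/8 + 5/4)/2` (`slip_instance_E2M3_Binary8p5`).  The
converse direction — at a prescribed midpoint a slip does occur — is
`DoubleRoundingThresholdWitness.lean` / `DoubleRoundingProductStrip.lean`.  Implementation A:
`code/enum/slip_midpoint_check.py` enumerates every slip of a sum or product with an FP4/FP6
source and every tabulated witness, and finds the intermediate on a midpoint each time.
References: [MartinDorelMelquiondMuller2013] Property 2.1; [Figueroa1995] §2;
[BoldoMelquiond2008] §III (midpoints of `φ` are values — indeed even ones — of `ψ`).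
-/

namespace Summit.Ventures.CertifiedArithmetic

open Literature.ComputerArithmetic.FloatingPoint
open Literature.ComputerArithmetic.FloatingPoint.Format
open Literature.ComputerArithmetic.FloatingPoint.MiniFloat

/-- PROPERTY 2.1 FOR FORMAT RECORDS (positive inputs): for formats `φ`, `ψ` with
`P_φ + 1 ≤ P_ψ`, `bias φ ≤ bias ψ`, `maxRat φ ≤ maxRat ψ` and a rational `x > 0` at which the
double rounding slips, `fl_φ (fl_ψ x) ≠ fl_φ x`, there are consecutive values `0 ≤ v < u` of `φ`
(none strictly between) with `v < x < u` and `fl_ψ x = (v + u)/2 ≠ x`.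
[cite: MartinDorelMelquiondMuller2013, Property 2.1] -/
theorem slip_midpoint_of_pos {φ ψ : Format} (hm1 : φ.manBits + 1 ≤ ψ.manBits)
    (hb : φ.bias ≤ ψ.bias) (hmax : φ.maxRat ≤ ψ.maxRat) {x : ℚ} (hx : 0 < x)
    (h : (roundNE φ (roundNE ψ x).toRat).toRat ≠ (roundNE φ x).toRat) :
    ∃ v u : MiniFloat φ, 0 ≤ v.toRat ∧ v.toRat < x ∧ x < u.toRat ∧
      (∀ y : MiniFloat φ, y.toRat ≤ v.toRat ∨ u.toRat ≤ y.toRat) ∧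
      (roundNE ψ x).toRat = (v.toRat + u.toRat) / 2 ∧ x ≠ (roundNE ψ x).toRat := by
  have hqφ := φ.quantum_pos
  have hmle : φ.manBits ≤ ψ.manBits := by omega
  have hq : ψ.qexp ≤ φ.qexp := qexp_le_of_le hmle hb
  -- `x` is not a value of `ψ` (a value is rounded to itself), hence not of `φ`
  have hex : ¬ ∃ z : MiniFloat ψ, z.toRat = x :=
    fun hex => h (toRat_roundNE_roundNE_of_exists hex)
  -- `x < maxRat φ`: above it both routes saturate
  have hbig : ¬ φ.maxRat ≤ x := by
    intro hbig
    apply h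
    have htop : ∃ z : MiniFloat ψ, z.toRat = φ.maxRat := by
      obtain ⟨z, hz⟩ := exists_toRat_eq_of_le hmle hq hmax (top φ)
      exact ⟨z, by rw [hz, toRat_top]⟩
    have hw : φ.maxRat ≤ (roundNE ψ x).toRat := by
      have h1 := toRat_roundNE_mono (φ := ψ) hbig
      rwa [toRat_roundNE_of_exists htop] at h1
    rw [toRat_roundNE_of_maxRat_le_pos hw, toRat_roundNE_of_maxRat_le_pos hbig]
  have hbig' : x < φ.maxRat := not_le.mp hbig
  have hnsφ : ¬ ∃ y : MiniFloat φ, y.toRat = x := by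
    rintro ⟨y, hy⟩
    obtain ⟨z, hz⟩ := exists_toRat_eq_of_le hmle hq hmax y
    exact hex ⟨z, hz.trans hy⟩
  -- the bracket `v < x < u = v + G` of consecutive values of `φ`, and its midpoint in `ψ`
  obtain ⟨hv0, hvs, hsu, ⟨u, hu⟩, hgap⟩ := roundDown_bracket hx hbig' hnsφ
  set v := roundDown φ x with hv_def
  set G := 2 ^ (v.expCode - 1) * φ.quantum with hG_def
  have hG : 0 < G := by positivity
  have hvψ : ∃ z : MiniFloat ψ, z.toRat = v.toRat := exists_toRat_eq_of_le hmle hq hmax v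
  have huψ : ∃ z : MiniFloat ψ, z.toRat = v.toRat + G := by
    obtain ⟨z, hz⟩ := exists_toRat_eq_of_le hmle hq hmax u
    exact ⟨z, hz.trans hu⟩
  have hMψ : ∃ z : MiniFloat ψ, z.toRat = v.toRat + G / 2 :=
    exists_toRat_eq_midpoint hm1 hb hmax hv0 hu
  have hsM : x ≠ v.toRat + G / 2 := by
    intro h'; obtain ⟨z, hz⟩ := hMψ; exact hex ⟨z, hz.trans h'.symm⟩
  have hgap' : ∀ y : MiniFloat φ, y.toRat ≤ v.toRat ∨ u.toRat ≤ y.toRat := by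
    intro y; rw [hu]; exact hgap y
  set w := (roundNE ψ x).toRat with hw_def
  suffices hwEq : w = v.toRat + G / 2 by
    refine ⟨v, u, hv0, hvs, by rw [hu]; exact hsu, hgap', by rw [hwEq, hu]; ring, ?_⟩
    rw [hwEq]; exact hsM
  rcases lt_or_gt_of_ne hsM with hlt | hgt
  · -- `x < M`: `w ∈ [v, M]`, and `w < M` would make both routes deliver `v`
    have hwv : v.toRat ≤ w := by
      have := toRat_roundNE_mono (φ := ψ) hvs.le; rwa [toRat_roundNE_of_exists hvψ] at this
    have hwM : w ≤ v.toRat + G / 2 := by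
      have := toRat_roundNE_mono (φ := ψ) hlt.le; rwa [toRat_roundNE_of_exists hMψ] at this
    rcases eq_or_lt_of_le hwM with hwEq | hwLt
    · exact hwEq
    · exfalso; apply h
      rw [toRat_roundNE_eq_of_forall_lt ⟨v, rfl⟩ (forall_lt_of_mem_low hgap hwv hwLt),
        toRat_roundNE_eq_of_forall_lt ⟨v, rfl⟩ (forall_lt_of_mem_low hgap hvs.le hlt)]
  · -- `x > M`: `w ∈ [M, u]`, and `w > M` would make both routes deliver `u`
    have hwu : w ≤ v.toRat + G := by
      have := toRat_roundNE_mono (φ := ψ) hsu.le; rwa [toRat_roundNE_of_exists huψ] at this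
    have hwM : v.toRat + G / 2 ≤ w := by
      have := toRat_roundNE_mono (φ := ψ) hgt.le; rwa [toRat_roundNE_of_exists hMψ] at this
    rcases eq_or_lt_of_le hwM with hwEq | hwGt
    · exact hwEq.symm
    · exfalso; apply h
      rw [toRat_roundNE_eq_of_forall_lt ⟨u, rfl⟩ (forall_lt_of_mem_high hu hgap hwGt hwu),
        toRat_roundNE_eq_of_forall_lt ⟨u, rfl⟩ (forall_lt_of_mem_high hu hgap hgt hsu.le)]

/-- PROPERTY 2.1 FOR FORMAT RECORDS (every input): under the same hypotheses a slip at any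
rational `x` forces `|fl_ψ x|` onto the midpoint of two consecutive values `0 ≤ v < u` of `φ`
enclosing `|x|` strictly (`x = 0` and the values of `ψ` never slip; negative inputs by the
symmetry of round-to-nearest-even). [cite: MartinDorelMelquiondMuller2013, Property 2.1] -/
theorem slip_midpoint {φ ψ : Format} (hm1 : φ.manBits + 1 ≤ ψ.manBits)
    (hb : φ.bias ≤ ψ.bias) (hmax : φ.maxRat ≤ ψ.maxRat) {x : ℚ}
    (h : (roundNE φ (roundNE ψ x).toRat).toRat ≠ (roundNE φ x).toRat) :
    ∃ v u : MiniFloat φ, 0 ≤ v.toRat ∧ v.toRat < |x| ∧ |x| < u.toRat ∧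
      (∀ y : MiniFloat φ, y.toRat ≤ v.toRat ∨ u.toRat ≤ y.toRat) ∧
      |(roundNE ψ x).toRat| = (v.toRat + u.toRat) / 2 ∧ |x| ≠ |(roundNE ψ x).toRat| := by
  rcases lt_trichotomy 0 x with hpos | hzero | hneg
  · obtain ⟨v, u, hv0, hvx, hxu, hgap, hw, hne⟩ := slip_midpoint_of_pos hm1 hb hmax hpos h
    have hw0 : 0 ≤ (roundNE ψ x).toRat := by rw [hw]; linarith
    refine ⟨v, u, hv0, ?_, ?_, hgap, ?_, ?_⟩ <;>
      simp only [abs_of_pos hpos, abs_of_nonneg hw0] <;> assumption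
  · exfalso; apply h
    exact toRat_roundNE_roundNE_of_exists ⟨MiniFloat.zero ψ, by rw [toRat_zero]; exact hzero⟩
  · have h' : (roundNE φ (roundNE ψ (-x)).toRat).toRat ≠ (roundNE φ (-x)).toRat := by
      rw [toRat_roundNE_neg, toRat_roundNE_neg, toRat_roundNE_neg]
      exact fun e => h (neg_inj.mp e)
    obtain ⟨v, u, hv0, hvx, hxu, hgap, hw, hne⟩ :=
      slip_midpoint_of_pos hm1 hb hmax (by linarith) h'
    rw [toRat_roundNE_neg] at hw hne
    have hw0 : (roundNE ψ x).toRat ≤ 0 := by linarith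
    refine ⟨v, u, hv0, ?_, ?_, hgap, ?_, ?_⟩ <;>
      simp only [abs_of_neg hneg, abs_of_nonpos hw0] <;> assumption

/-- INNOCUOUS OFF THE MIDPOINTS — for every pair of format records with `P_φ + 1 ≤ P_ψ`,
`bias φ ≤ bias ψ`, `maxRat φ ≤ maxRat ψ`, and ANY rational `x` (the exact result of any
operation): if `|fl_ψ x|` is not the midpoint of two consecutive values of `φ`, then
`fl_φ (fl_ψ x) = fl_φ x`. [cite: MartinDorelMelquiondMuller2013, Property 2.1] -/
theorem roundNE_roundNE_of_not_midpoint {φ ψ : Format} (hm1 : φ.manBits + 1 ≤ ψ.manBits)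
    (hb : φ.bias ≤ ψ.bias) (hmax : φ.maxRat ≤ ψ.maxRat) {x : ℚ}
    (hnm : ∀ v u : MiniFloat φ, 0 ≤ v.toRat → v.toRat < u.toRat →
      (∀ y : MiniFloat φ, y.toRat ≤ v.toRat ∨ u.toRat ≤ y.toRat) →
      |(roundNE ψ x).toRat| ≠ (v.toRat + u.toRat) / 2) :
    (roundNE φ (roundNE ψ x).toRat).toRat = (roundNE φ x).toRat := by
  by_contra h
  obtain ⟨v, u, hv0, hvx, hxu, hgap, hw, -⟩ := slip_midpoint hm1 hb hmax h
  exact hnm v u hv0 (by linarith) hgap hw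

/-- THE SLIPPED INPUT IS NOT THE MIDPOINT AND NOT A VALUE: under the same hypotheses a slip at
`x` implies that `x` is not a value of `ψ` (nor of `φ`) and `|x| < maxRat φ` — exact products
and sums and saturated ones never slip. [cite: MartinDorelMelquiondMuller2013, Property 2.1] -/
theorem not_exists_of_slip {φ ψ : Format} (hm1 : φ.manBits + 1 ≤ ψ.manBits)
    (hb : φ.bias ≤ ψ.bias) (hmax : φ.maxRat ≤ ψ.maxRat) {x : ℚ}
    (h : (roundNE φ (roundNE ψ x).toRat).toRat ≠ (roundNE φ x).toRat) :
    (¬ ∃ z : MiniFloat ψ, z.toRat = x) ∧ |x| < φ.maxRat := by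
  obtain ⟨v, u, hv0, hvx, hxu, hgap, hw, hne⟩ := slip_midpoint hm1 hb hmax h
  refine ⟨fun hex => h (toRat_roundNE_roundNE_of_exists hex), lt_of_lt_of_le hxu ?_⟩
  have := abs_toRat_le_maxRat u
  exact le_trans (le_abs_self _) this

/-- THE INSTANCE e2m3 → binary8p5 of the product matrix D-dm: the first failing pair
`5/8 · 15/8 = 75/64` is rounded by binary8p5 onto `19/16`, the midpoint of the consecutive
e2m3 values `9/8` and `5/4`, whose tie resolves to the even side `5/4`, while the direct
rounding of `75/64` is `9/8` (cf. `precisionDeficient_mul_fails`).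
[cite: MartinDorelMelquiondMuller2013, Property 2.1] -/
theorem slip_instance_E2M3_Binary8p5 :
    (roundNE Binary8p5 (75 / 64 : ℚ)).toRat
        = ((⟨false, 1, 1, by decide, by decide, by decide⟩ : MiniFloat E2M3).toRat
          + (⟨false, 1, 2, by decide, by decide, by decide⟩ : MiniFloat E2M3).toRat) / 2 ∧
    (roundNE E2M3 (roundNE Binary8p5 (75 / 64 : ℚ)).toRat).toRat = 5 / 4 ∧
    (roundNE E2M3 (75 / 64 : ℚ)).toRat = 9 / 8 := by
  refine ⟨?_, ?_, ?_⟩ <;> decide +kernel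

end Summit.Ventures.CertifiedArithmetic
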